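import Summits.ResolutionOfSingularities.ResolutionOfSingularities.Theorems.PAlterationPialtRankOneAtoms
import Literature.AlgebraicGeometry.Resolution.RankOneReductionProofs
import Literature.AlgebraicGeometry.Resolution.LocalUniformizationClosedPoints
import Literature.AlgebraicGeometry.Resolution.GeneralLU
import HarnessLib

/-!
# Crux `Pialt` (stmt-ResolutionOfSingularities-0555), line `SketchIdeator2` v5: OPEN RANGE of the LU atom —
# relative local uniformization descends along a finitely generated extension of the GROUND field inside the
# valuation ring; in transcendence degree `n + 1` it reduces to ZERO-DIMENSIONAL valuations modulo transcendence
# degree `n` (over all fields); transcendence degree 4 modulo `CossartPiltant2019`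

Line lead c5 (prover-line-stmt-ResolutionOfSingularities-0555-c5-0, 2026-08-17). The v5 LU atom
`stub_relLURankOneNonAbhyankarPerfect` (relative LU of rank-one non-Abhyankar valuation rings of function fields
over perfect fields) is open from transcendence degree 4. This file proves the positive half of "zero-dimensional"
can be added to "rank one, non-Abhyankar" in the first open transcendence degree:

* `RelLocalUniformization.of_intermediateField` — **ground-field descent of relative LU**: if `k ⊆ F ⊆ O ⊆ K` with
  `F` an intermediate field finitely generated over `k` and contained in the valuation ring `O`, then relative LU of
  `O` over the ground field `F` implies relative LU of `O` over `k` (an `F`-model `F[S]` regular at the centre is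
  the localisation of the `k`-model `k[T, S, …]`, `F = k(T)`, at `ν`-units: the non-zero elements of the subfield
  `F ⊆ O` are units of `O`; Novacoski–Spivakovsky's Lemma 2.5 (1) device, `centreLocalization_le`). No hypothesis on
  `k` (perfectness is not preserved: `F = k(T)` is not perfect).
* `adjoin_simple_le_valuationSubring_of_residuallyTranscendental`, `trdeg_adjoin_simple_le_of_residuallyTranscendental`
  — an element `x ∈ O` which is RESIDUALLY TRANSCENDENTAL over `k` (`f(x)` is a unit of `O` for every non-zero
  `f ∈ k[X]`) generates a subfield `k(x) ⊆ O`, and `trdeg_{k(x)} K ≤ n` when `trdeg_k K ≤ n + 1`.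
* `relLU_of_relLU_trdeg_le_of_residuallyTranscendental` — **reduction**: relative LU in transcendence degree `≤ n`
  over ALL fields implies relative LU in transcendence degree `≤ n + 1` at every valuation ring that is NOT
  zero-dimensional (contains a residually transcendental element), over all fields. (The complementary reduction
  `relLU_of_relLU_zeroDim`, Zariski, refines an arbitrary valuation to a zero-dimensional one of HIGHER rank; the
  two together do not combine with "rank one" at a fixed ground field, which is why the calibration below is stated
  in transcendence degree 4 only.)
* `relLU_of_cossartPiltant2019_of_trdeg_le_four_of_residuallyTranscendental` — modulo `CossartPiltant2019`
  (resolution of arithmetical threefolds, hence relative LU in trdeg ≤ 3 over EVERY field,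
  `CossartPiltant2019.relLocalUniformization`): in transcendence degree `≤ 4` over any field, every valuation ring
  containing a residually transcendental element admits relative LU.
* `relLURankOneNonAbhyankarPerfect_of_trdeg_le_three`, `relLURankOneNonAbhyankarPerfect_of_trdeg_le_four_of_not_zeroDim`
  — the registered v5 atom's binders VERBATIM + one hypothesis, mod `CossartPiltant2019`: the atom holds in trdeg
  ≤ 3, and in trdeg ≤ 4 unless `O` is zero-dimensional. **First open case of the LU atom: a ZERO-DIMENSIONAL
  rank-one valuation of rational rank 1, 2 or 3 on a function field of transcendence degree 4 over a perfect field**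
  (rank, non-Abhyankar-ness and perfectness idle in the calibration).

References: O. Zariski, P. Samuel, *Commutative Algebra* II, Ch. VI §17; J. Novacoski, M. Spivakovsky, EMS Congr.
Rep. (2014), Lemma 2.5 (1), Def. 2.20; V. Cossart, O. Piltant, J. Algebra 529 (2019), Thm. 1.1.
-/

set_option linter.dupNamespace false

noncomputable section

open IsLocalRing
open Literature.AlgebraicGeometry.Resolution

namespace Summit.ResolutionOfSingularities.ResolutionOfSingularities.Theorems.Pialt.OpenRange

/-! ## Ground-field descent of relative local uniformization -/

section descent

variable {k K : Type} [Field k] [Field K] [Algebra k K]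

/-- A non-zero element of a subfield contained in a valuation ring is a unit of valuation `1`. [folklore] -/
theorem valuation_eq_one_of_mem_intermediateField (F : IntermediateField k K) (O : ValuationSubring K)
    (hFO : (F : Set K) ⊆ O) {z : K} (hz : z ∈ F) (hz0 : z ≠ 0) : O.valuation z = 1 := by
  apply le_antisymm ((O.valuation_le_one_iff z).mpr (hFO hz))
  have hinv : z⁻¹ ∈ O := hFO (F.inv_mem hz)
  have := (O.valuation_le_one_iff z⁻¹).mpr hinv
  rwa [map_inv₀, inv_le_one₀ ((Valuation.pos_iff _).mpr hz0)] at this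

/-- **Ground-field descent of relative local uniformization.** Let `k ⊆ F ⊆ K` with `F` an intermediate field
finitely generated over `k` and contained in the valuation ring `O` of `K`. If `O` admits relative local
uniformization over the ground field `F`, it admits relative local uniformization over `k`: a finitely generated
`k`-model `R ⊆ O` generates the `F`-model `F[R]`, dominated inside `O` by an `F`-model `F[S]` regular at the
centre; the `k`-model `A := k[T, S, R]` (`F = k(T)`) satisfies `A ⊆ F[S] ⊆ A_𝔭` (non-zero elements of `F ⊆ O`
are `ν`-units), so `A` and `F[S]` have the same local ring at the centre (Novacoski–Spivakovsky 2014,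
Lemma 2.5 (1)). [cite: NovacoskiSpivakovsky2014, Lemma 2.5 (1) and Def. 2.20] -/
theorem _root_.Literature.AlgebraicGeometry.Resolution.RelLocalUniformization.of_intermediateField
    (F : IntermediateField k K) (hF : F.FG) (O : ValuationSubring K) (hFO : (F : Set K) ⊆ O)
    (h : RelLocalUniformization F K O) : RelLocalUniformization k K O := by
  classical
  intro R hRfg hRfr hRO
  obtain ⟨T, hT⟩ := hF
  obtain ⟨s, hs⟩ := hRfg
  haveI := hRfr
  -- the `F`-model generated by `R`
  let OF : Subalgebra F K := { O.toSubring with algebraMap_mem' := fun c => hFO c.2 }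
  let R' : Subalgebra F K := Algebra.adjoin F (s : Set K)
  have hRR' : (R : Set K) ⊆ R' := by
    rw [← hs]
    show ((Algebra.adjoin k (s : Set K)) : Set K) ⊆ Algebra.adjoin F (s : Set K)
    rw [← Algebra.adjoin_adjoin_of_tower k (S := F) (s : Set K)]
    exact Algebra.subset_adjoin
  have hR'O : R'.toSubring ≤ O.toSubring := by
    have hle : R' ≤ OF := Algebra.adjoin_le fun x hx => hRO (hs ▸ Algebra.subset_adjoin hx)
    intro x hx
    exact (show x ∈ OF from hle hx)
  have hR'fr : IsFractionRing R' K := by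
    refine IsFractionRing.of_field R' K fun z => ?_
    obtain ⟨a, b, -, rfl⟩ := IsFractionRing.div_surjective (A := R) z
    exact ⟨⟨a, hRR' a.2⟩, ⟨b, hRR' b.2⟩, rfl⟩
  obtain ⟨A', hA'O, hR'A', hA'fg, hreg⟩ := h R' (Subalgebra.fg_adjoin_finset _) hR'fr hR'O
  obtain ⟨S, hS⟩ := hA'fg
  -- the `k`-model
  let A : Subalgebra k K := Algebra.adjoin k ((T ∪ S ∪ s : Finset K) : Set K)
  have hAeq : A = Algebra.adjoin k ((T : Set K) ∪ (S : Set K) ∪ (s : Set K)) := by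
    simp only [A, Finset.coe_union]
  have hTF : (T : Set K) ⊆ F := by rw [← hT]; exact IntermediateField.subset_adjoin k _
  have hAA' : (A : Set K) ⊆ A' := by
    have : A ≤ A'.restrictScalars k := by
      rw [hAeq]
      refine Algebra.adjoin_le ?_
      rintro x ((hx | hx) | hx)
      · exact A'.algebraMap_mem ⟨x, hTF hx⟩
      · rw [Subalgebra.coe_restrictScalars, ← hS]; exact Algebra.subset_adjoin hx
      · exact hR'A' (hRR' (hs ▸ Algebra.subset_adjoin hx))
    exact fun x hx => this hx
  have hAO : A.toSubring ≤ O.toSubring := fun x hx => hA'O (hAA' hx)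
  have hRA : R ≤ A := by
    rw [hAeq, ← hs]
    exact Algebra.adjoin_mono fun x hx => Or.inr hx
  refine ⟨A, hAO, hRA, ⟨_, rfl⟩, ?_⟩
  -- compare the local rings at the centre inside `K`
  let A'k : Subalgebra k K := A'.restrictScalars k
  have hA'kO : A'k.toSubring ≤ O.toSubring := fun x hx => hA'O hx
  haveI : IsFractionRing A.toSubring K := isFractionRing_subalgebra_of_le R A hRA
  haveI : IsFractionRing A'k.toSubring K :=
    isFractionRing_subalgebra_of_le R A'k fun x hx => hR'A' (hRR' hx)
  -- `F ⊆ L(A)`: elements of `F = k(T)` are quotients of elements of `k[T] ⊆ A` by `ν`-units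
  have hkTA : (Algebra.adjoin k (T : Set K) : Set K) ⊆ A := by
    rw [hAeq]
    exact Algebra.adjoin_mono fun x hx => Or.inl (Or.inl hx)
  have hkTF : (Algebra.adjoin k (T : Set K) : Set K) ⊆ F := by
    rw [← hT]; exact IntermediateField.algebra_adjoin_le_adjoin k _
  have hFLA : (F : Set K) ⊆ (Localization.subalgebra.ofField K
      ((maximalIdeal O).comap (Subring.inclusion hAO)).primeCompl
      (Ideal.primeCompl_le_nonZeroDivisors _)) := by
    intro z hz
    have hz' : z ∈ IntermediateField.adjoin k (T : Set K) := by rw [hT]; exact hz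
    rw [IntermediateField.mem_adjoin_iff_div] at hz'
    obtain ⟨r, hr, w, hw, rfl⟩ := hz'
    rw [SetLike.mem_coe, mem_centreLocalization_iff]
    by_cases hw0 : w = 0
    · exact ⟨0, A.zero_mem, 1, A.one_mem, by simp, by simp [hw0]⟩
    · exact ⟨r, hkTA hr, w, hkTA hw,
        valuation_eq_one_of_mem_intermediateField F O hFO (hkTF hw) hw0, div_eq_mul_inv r w⟩
  -- `A' ⊆ L(A)`
  have h1 : (A'k : Set K) ⊆ (Localization.subalgebra.ofField K
      ((maximalIdeal O).comap (Subring.inclusion hAO)).primeCompl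
      (Ideal.primeCompl_le_nonZeroDivisors _)) := by
    let LA : Subalgebra F K :=
      { ((Localization.subalgebra.ofField K
          ((maximalIdeal O).comap (Subring.inclusion hAO)).primeCompl
          (Ideal.primeCompl_le_nonZeroDivisors _))).toSubring with
        algebraMap_mem' := fun c => hFLA c.2 }
    have hSA : (S : Set K) ⊆ A := by
      rw [hAeq]
      exact fun x hx => Algebra.subset_adjoin (Or.inl (Or.inr hx))
    have : A' ≤ LA := by
      rw [← hS]
      refine Algebra.adjoin_le fun x hx => ?_
      exact le_centreLocalization O A hAO (hSA hx)
    exact fun x hx => this hx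
  -- `A ⊆ L(A')`
  have h2 : (A : Set K) ⊆ (Localization.subalgebra.ofField K
      ((maximalIdeal O).comap (Subring.inclusion hA'kO)).primeCompl
      (Ideal.primeCompl_le_nonZeroDivisors _)) :=
    hAA'.trans (le_centreLocalization O A'k hA'kO)
  have heq : ((Localization.subalgebra.ofField K
      ((maximalIdeal O).comap (Subring.inclusion hAO)).primeCompl
      (Ideal.primeCompl_le_nonZeroDivisors _)) : Set K)
      = (Localization.subalgebra.ofField K
      ((maximalIdeal O).comap (Subring.inclusion hA'kO)).primeCompl
      (Ideal.primeCompl_le_nonZeroDivisors _)) :=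
    le_antisymm (centreLocalization_le O A A'k hAO hA'kO h2)
      (centreLocalization_le O A'k A hA'kO hAO h1)
  -- regularity of the `F`-model, read on the subring `A'k.toSubring = A'.toSubring`
  have key : ∀ (S' : Subring K) (_ : S' = A'.toSubring) (hS' : S' ≤ O.toSubring),
      IsRegularLocalRing (Localization.AtPrime ((maximalIdeal O).comap (Subring.inclusion hS'))) := by
    rintro S' rfl hS'
    exact hreg
  have hreg' : IsRegularLocalRing
      (Localization.AtPrime ((maximalIdeal O).comap (Subring.inclusion hA'kO))) :=
    key A'k.toSubring (SetLike.ext' rfl) hA'kO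
  exact isRegularLocalRing_of_centreLocalization_eq O A A'k hAO hA'kO heq hreg'

end descent

/-! ## Residually transcendental elements -/

section residuallyTranscendental

variable {k K : Type} [Field k] [Field K] [Algebra k K]

/-- A residually transcendental element of `O` is transcendental over `k`. [folklore] -/
theorem transcendental_of_residuallyTranscendental (O : ValuationSubring K) {x : K}
    (hx : ∀ f : Polynomial k, f ≠ 0 → Polynomial.aeval x f ∉ O.nonunits) : Transcendental k x := by
  intro halg
  obtain ⟨f, hf0, hfx⟩ := halg
  exact hx f hf0 (by rw [hfx]; exact O.nonunits.zero_mem)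

/-- **A residually transcendental element generates a subfield of the valuation ring**: if `x ∈ O` and `f(x)` is
a unit of `O` for every non-zero `f ∈ k[X]`, then `k(x) ⊆ O`. [cite: ZariskiSamuel1960, Ch. VI §17] -/
theorem adjoin_simple_le_valuationSubring_of_residuallyTranscendental (O : ValuationSubring K)
    (hk : ∀ c : k, algebraMap k K c ∈ O) {x : K} (hxO : x ∈ O)
    (hx : ∀ f : Polynomial k, f ≠ 0 → Polynomial.aeval x f ∉ O.nonunits) :
    ((IntermediateField.adjoin k {x} : IntermediateField k K) : Set K) ⊆ O := by
  -- `k[x] ⊆ O`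
  let Ok : Subalgebra k K := { O.toSubring with algebraMap_mem' := hk }
  have hkx : Algebra.adjoin k {x} ≤ Ok := Algebra.adjoin_le (Set.singleton_subset_iff.mpr hxO)
  intro z hz
  rw [SetLike.mem_coe, IntermediateField.mem_adjoin_simple_iff] at hz
  obtain ⟨r, w, rfl⟩ := hz
  have hr : Polynomial.aeval x r ∈ O := hkx (Polynomial.aeval_mem_adjoin_singleton k x)
  have hw : Polynomial.aeval x w ∈ O := hkx (Polynomial.aeval_mem_adjoin_singleton k x)
  by_cases hw0 : w = 0
  · simp [hw0, O.zero_mem]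
  · have hu : Polynomial.aeval x w ∉ O.nonunits := hx w hw0
    rw [ValuationSubring.mem_nonunits_iff, not_lt] at hu
    have h1 : O.valuation (Polynomial.aeval x w) = 1 :=
      le_antisymm ((O.valuation_le_one_iff _).mpr hw) hu
    have hne : Polynomial.aeval x w ≠ 0 := by
      intro h0; rw [h0, map_zero] at h1; exact zero_ne_one h1
    have hinv : (Polynomial.aeval x w)⁻¹ ∈ O := by
      rw [← O.valuation_le_one_iff, map_inv₀, h1, inv_one]
    rw [div_eq_mul_inv]
    exact O.mul_mem _ _ hr hinv

/-- **Transcendence degree drops by one over `k(x)`** for `x` transcendental over `k`: if `trdeg_k K ≤ n + 1` then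
`trdeg_{k(x)} K ≤ n` (tower law, Stacks 030H). [folklore] -/
theorem trdeg_adjoin_simple_le_of_transcendental {x : K} (hx : Transcendental k x) {n : ℕ}
    (hK : Algebra.trdeg k K ≤ (n + 1 : ℕ)) :
    Algebra.trdeg (IntermediateField.adjoin k {x}) K ≤ n := by
  set F : IntermediateField k K := IntermediateField.adjoin k {x} with hFdef
  have htower := trdeg_add_eq k F (A := K)
  -- `1 ≤ trdeg_k F`
  have hxF : Transcendental k (⟨x, IntermediateField.mem_adjoin_simple_self k x⟩ : F) := by
    rw [← transcendental_algebraMap_iff (algebraMap F K).injective]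
    exact hx
  haveI : Algebra.Transcendental k F := ⟨⟨_, hxF⟩⟩
  have h1 : 1 ≤ Algebra.trdeg k F := Cardinal.one_le_iff_pos.mpr (trdeg_pos k F)
  -- arithmetic
  have hle : Algebra.trdeg F K + 1 ≤ (n : Cardinal) + 1 := by
    calc Algebra.trdeg F K + 1 ≤ Algebra.trdeg F K + Algebra.trdeg k F := by gcongr
      _ = Algebra.trdeg k K := by rw [add_comm, htower]
      _ ≤ (n + 1 : ℕ) := hK
      _ = (n : Cardinal) + 1 := by push_cast; rfl
  by_cases hfin : Algebra.trdeg F K < Cardinal.aleph0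
  · obtain ⟨m, hm⟩ := Cardinal.lt_aleph0.mp hfin
    rw [hm] at hle ⊢
    have : (m + 1 : ℕ) ≤ ((n + 1 : ℕ) : Cardinal) := by push_cast; exact hle
    exact_mod_cast Nat.le_of_succ_le_succ (by exact_mod_cast this)
  · exfalso
    rw [not_lt] at hfin
    have h2 : Cardinal.aleph0 ≤ (n : Cardinal) + 1 :=
      hfin.trans ((self_le_add_right _ _).trans hle)
    have h3 : ((n + 1 : ℕ) : Cardinal) < Cardinal.aleph0 := Cardinal.natCast_lt_aleph0
    push_cast at h3
    exact absurd (h2.trans_lt h3) (lt_irrefl _)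

/-- Combined: a residually transcendental `x ∈ O` yields an intermediate field `k(x) ⊆ O`, finitely generated over
`k`, over which `K` has transcendence degree `≤ n` if `trdeg_k K ≤ n + 1`. [folklore] -/
theorem trdeg_adjoin_simple_le_of_residuallyTranscendental (O : ValuationSubring K) {x : K}
    (hx : ∀ f : Polynomial k, f ≠ 0 → Polynomial.aeval x f ∉ O.nonunits) {n : ℕ}
    (hK : Algebra.trdeg k K ≤ (n + 1 : ℕ)) :
    Algebra.trdeg (IntermediateField.adjoin k {x}) K ≤ n :=
  trdeg_adjoin_simple_le_of_transcendental (transcendental_of_residuallyTranscendental O hx) hK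

end residuallyTranscendental

/-! ## The reduction: transcendence degree `n + 1` at non-zero-dimensional valuations from transcendence degree `n` -/

/-- **Relative LU in transcendence degree `≤ n` over all fields implies relative LU in transcendence degree `≤ n + 1`
at every valuation ring containing a RESIDUALLY TRANSCENDENTAL element**, over all fields (universe `0`): extend
the ground field to `k(x) ⊆ O` and descend (`RelLocalUniformization.of_intermediateField`). Zariski's reduction to
zero-dimensional valuations read upward in the transcendence degree. [cite: ZariskiSamuel1960, Ch. VI §17] -/
theorem relLU_of_relLU_trdeg_le_of_residuallyTranscendental {n : ℕ}
    (hLU : ∀ (k K : Type) [Field k] [Field K] [Algebra k K], Algebra.trdeg k K ≤ n →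
      ∀ O : ValuationSubring K, RelLocalUniformization k K O)
    (k K : Type) [Field k] [Field K] [Algebra k K] (hK : Algebra.trdeg k K ≤ (n + 1 : ℕ))
    (O : ValuationSubring K) (hk : ∀ c : k, algebraMap k K c ∈ O) {x : K} (hxO : x ∈ O)
    (hx : ∀ f : Polynomial k, f ≠ 0 → Polynomial.aeval x f ∉ O.nonunits) :
    RelLocalUniformization k K O :=
  RelLocalUniformization.of_intermediateField (IntermediateField.adjoin k {x})
    (IntermediateField.fg_adjoin_of_finite (Set.finite_singleton x)) O
    (adjoin_simple_le_valuationSubring_of_residuallyTranscendental O hk hxO hx)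
    (hLU _ K (trdeg_adjoin_simple_le_of_residuallyTranscendental O hx hK) O)

/-- **Transcendence degree 4 modulo `CossartPiltant2019`**: over any field, every valuation ring of a function field
of transcendence degree `≤ 4` containing a residually transcendental element admits relative local uniformization
(Cossart–Piltant 2019 gives relative LU in transcendence degree `≤ 3` over every field,
`CossartPiltant2019.relLocalUniformization`). [cite: CossartPiltant2019, Thm. 1.1] -/
theorem relLU_of_cossartPiltant2019_of_trdeg_le_four_of_residuallyTranscendental (hCP : CossartPiltant2019.{0})
    (k K : Type) [Field k] [Field K] [Algebra k K] (hK : Algebra.trdeg k K ≤ 4)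
    (O : ValuationSubring K) (hk : ∀ c : k, algebraMap k K c ∈ O) {x : K} (hxO : x ∈ O)
    (hx : ∀ f : Polynomial k, f ≠ 0 → Polynomial.aeval x f ∉ O.nonunits) :
    RelLocalUniformization k K O :=
  relLU_of_relLU_trdeg_le_of_residuallyTranscendental (n := 3)
    (fun k K _ _ _ hK O => hCP.relLocalUniformization k K hK O) k K (by exact_mod_cast hK) O hk hxO hx

/-! ## Calibrations of the registered v5 atom `stub_relLURankOneNonAbhyankarPerfect` (binders verbatim + one hypothesis) -/

/-- **The v5 LU atom holds in transcendence degree `≤ 3`** (mod `CossartPiltant2019`; rank, Abhyankar-ness and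
perfectness idle). [cite: CossartPiltant2019, Thm. 1.1] -/
theorem relLURankOneNonAbhyankarPerfect_of_trdeg_le_three (hCP : CossartPiltant2019.{0}) (p : ℕ)
    (_hp : p.Prime) :
    ∀ (k : Type) [Field k] [CharP k p] [PerfectField k] (K : Type) [Field K] [Algebra k K]
      (O : ValuationSubring K), (⊤ : IntermediateField k K).FG → (∀ c : k, algebraMap k K c ∈ O) →
      Nonempty O.valuation.RankOne → ¬ IsAbhyankarPlace O (algebraMap k K).fieldRange ⊤ →
      Algebra.trdeg k K ≤ 3 → RelLocalUniformization k K O :=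
  fun k _ _ _ K _ _ O _ _ _ _ hK => hCP.relLocalUniformization k K hK O

/-- **The v5 LU atom holds in transcendence degree `≤ 4` at every valuation ring which is NOT zero-dimensional**
(contains an element `x` with `f(x)` a unit for all non-zero `f ∈ k[X]`), mod `CossartPiltant2019`; rank,
Abhyankar-ness and perfectness idle. So the FIRST OPEN CASE of `stub_relLURankOneNonAbhyankarPerfect` is a
zero-dimensional (residue field algebraic over `k`) rank-one valuation of rational rank 1, 2 or 3 on a function field
of transcendence degree 4 over a perfect field — exactly the valuations with room for defect and no residual
transcendence to spend. [cite: CossartPiltant2019, Thm. 1.1] -/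
theorem relLURankOneNonAbhyankarPerfect_of_trdeg_le_four_of_not_zeroDim (hCP : CossartPiltant2019.{0}) (p : ℕ)
    (_hp : p.Prime) :
    ∀ (k : Type) [Field k] [CharP k p] [PerfectField k] (K : Type) [Field K] [Algebra k K]
      (O : ValuationSubring K), (⊤ : IntermediateField k K).FG → (∀ c : k, algebraMap k K c ∈ O) →
      Nonempty O.valuation.RankOne → ¬ IsAbhyankarPlace O (algebraMap k K).fieldRange ⊤ →
      Algebra.trdeg k K ≤ 4 →
      (∃ x ∈ O, ∀ f : Polynomial k, f ≠ 0 → Polynomial.aeval x f ∉ O.nonunits) →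
      RelLocalUniformization k K O :=
  fun k _ _ _ K _ _ O _ hk _ _ hK ⟨_, hxO, hx⟩ =>
    relLU_of_cossartPiltant2019_of_trdeg_le_four_of_residuallyTranscendental hCP k K hK O hk hxO hx

end Summit.ResolutionOfSingularities.ResolutionOfSingularities.Theorems.Pialt.OpenRange

end
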